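import Literature.AlgebraicGeometry.Modules.CechPullbackFunctorial
import Mathlib.Data.Prod.Lex
import HarnessLib

/-!
# Composites of pull-backs on ordered Čech classes for the projections, the group law, the swap and the two slices
# of a product-type cover (The Stacks Project, Tags 01FG, 01FP; Mumford, *Abelian Varieties* §13)

Layer `Literature/AlgebraicGeometry/Modules` (THEOREMS only: no definition, no instance, no notation, no named fact,
no `sorry`).  Cell `hodgecm-mathlib` FLOOR 0, P1 sub-line F-11, packet (iv)∕J3 «`Ȟ¹ ⊗ Ȟ¹ ↠ Ȟ²` for an abelian variety
over a field of characteristic `0`» ([MumfordAV1970] §13 via the Hopf-algebra structure of `Ȟ•(X, 𝒪_X)`), letters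
(G1-b)(G1-c)(G1-d) «the composites of the pull-backs on classes» of F0P1b-p02 (g2)'s F-J3b skeleton; F0P1a-p02 (g3).
HC_CM is proved only modulo the 7 printed citations until rung 0 closes — nothing here bears on a summit statement.

SETTING (all GENERIC — schemes and morphisms are variables, the scheme identities are hypotheses): schemes `X`, `P`
(think `P = X × X`), morphisms `p₁ p₂ m : P ⟶ X` (projections, group law), `sw : P ⟶ P` (swap), `i₁ i₂ : X ⟶ P`
(slices through the identity point), a cover `U : ι → X.Opens`, the PRODUCT cover `W₀ : ι ×ₗ ι → P.Opens`
(`W₀ (i, j) ⊆ p₁⁻¹ U_i ∩ p₂⁻¹ U_j`) and the TRIPLE cover `W : (ι ×ₗ ι) ×ₗ ι → P.Opens`,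
`W ((i, j), l) = W₀ (i, j) ∩ m⁻¹ U_l` (hypothesis `hW`), a distinguished index `j₀` with `U_i ⊆ i₁⁻¹ W₀ (i, j₀)`,
`U_i ⊆ i₂⁻¹ W₀ (j₀, i)`, and base rings `ρX`, `ρP` compatible with all maps.  The pull-backs on classes are the
★ `HomologicalComplex.homologyMap (refineComplexMap θ (pullbackSystemHom f …)) n` of ★ DEF #14∕#15 with the index maps
`θ_{p₁} = fst`, `θ_{p₂} = snd`, `θ_m ((i,j),l) = l` (into the TRIPLE cover), `θ_r ((i,j),l) = (i,j)` (the refinement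
`r : W → W₀` along `𝟙 P`), `θ_{sw} (i,j) = (j,i)`, `θ_{i₁} i = (i, j₀)`, `θ_{i₂} i = (j₀, i)`, and
`m^* := (r^*)⁻¹ ∘ m_W^*` when `r^*` is bijective (hypothesis `hr`, the (G5-c) letter).

RESULTS (each ONE or TWO instances of ★ `homologyMap_pullbackSystemHom_comp_apply` ∕ `…_id_apply` ∕
`…_apply_eq_zero_of_const` of ★ `Modules/CechPullbackFunctorial`; the composite index maps are definitionally `id`,
the constant `j₀`, `snd`, …):
* `prodCover_slice₁_proj₁_apply` ∕ `prodCover_slice₂_proj₂_apply` — `i₁^* p₁^* = 𝟙`, `i₂^* p₂^* = 𝟙` (`i₁ ≫ p₁ = 𝟙`);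
* `prodCover_slice₁_proj₂_apply_eq_zero` ∕ `prodCover_slice₂_proj₁_apply_eq_zero` — `i₁^* p₂^* = 0 = i₂^* p₁^*` on `Ȟⁿ`,
  `n ≥ 1` (constant composite index map; NO scheme identity needed);
* `prodCover_swap_proj₁_apply` ∕ `prodCover_swap_proj₂_apply` — `sw^* p₁^* = p₂^*`, `sw^* p₂^* = p₁^*` (`sw ≫ p₁ = p₂`);
* `prodCover_slice₁_mul_apply` ∕ `prodCover_slice₂_mul_apply` — `i₁^* m^* = 𝟙 = i₂^* m^*` (`i₁ ≫ m = 𝟙`; through the lift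
  `i₁_W : i ↦ ((i, j₀), i)` of `i₁` to the triple cover: `i₁^* = i₁_W^* ∘ r^*`, `i₁_W^* ∘ m_W^* = (i₁ ≫ m)^* = 𝟙`);
* `prodCover_swap_mul_apply` — `sw^* m^* = m^*` (`sw ≫ m = m`, commutativity; through the lift `sw_W ((i,j),l) = ((j,i),l)`:
  `r^* sw^* = sw_W^* r^*`, `sw_W^* m_W^* = m_W^*`, and injectivity of `r^*`).

## References
* The Stacks Project, Tag 01FG, Tag 01FP (functoriality of Čech pull-backs; refinements). [StacksProject]
* D. Mumford, *Abelian Varieties* (1970), §13 (the maps `p₁^*, p₂^*, m^*, s^*` on `H•(X, 𝒪_X)`). [MumfordAV1970]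
-/

noncomputable section

universe u

-- `ModuleCat`-valued functors and `TopCat.Presheaf` are not reducible (as in ★ `CechPullbackFunctorial`).
set_option backward.isDefEq.respectTransparency false

open CategoryTheory AlgebraicGeometry TopologicalSpace Opposite

namespace Literature.AlgebraicGeometry.Modules

open Literature.Algebra.Homology Literature.Algebra.Homology.OrderedCech

variable {X P : Scheme.{u}} (p₁ p₂ m : P ⟶ X) (sw : P ⟶ P) (i₁ i₂ : X ⟶ P) {ι : Type} [LinearOrder ι]
  (U : ι → X.Opens) (W₀ : ι ×ₗ ι → P.Opens) (W : (ι ×ₗ ι) ×ₗ ι → P.Opens)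
  (hW : ∀ c : (ι ×ₗ ι) ×ₗ ι, W c = W₀ (ofLex c).1 ⊓ m ⁻¹ᵁ U (ofLex c).2)
  (hW₀p₁ : ∀ c : ι ×ₗ ι, W₀ c ≤ p₁ ⁻¹ᵁ U (ofLex c).1) (hW₀p₂ : ∀ c : ι ×ₗ ι, W₀ c ≤ p₂ ⁻¹ᵁ U (ofLex c).2)
  (hWm : ∀ c : (ι ×ₗ ι) ×ₗ ι, W c ≤ m ⁻¹ᵁ U (ofLex c).2)
  (hWr : ∀ c : (ι ×ₗ ι) ×ₗ ι, W c ≤ (𝟙 P) ⁻¹ᵁ W₀ (ofLex c).1)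
  (hsw : ∀ c : ι ×ₗ ι, W₀ c ≤ sw ⁻¹ᵁ W₀ (toLex ((ofLex c).2, (ofLex c).1)))
  (j₀ : ι) (hi₁ : ∀ i : ι, U i ≤ i₁ ⁻¹ᵁ W₀ (toLex (i, j₀))) (hi₂ : ∀ i : ι, U i ≤ i₂ ⁻¹ᵁ W₀ (toLex (j₀, i)))
  {A : Type u} [CommRing A] (ρX : A →+* Γ(X, ⊤)) (ρP : A →+* Γ(P, ⊤))
  (hρp₁ : ∀ a, ρP a = p₁.appTop (ρX a)) (hρp₂ : ∀ a, ρP a = p₂.appTop (ρX a))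
  (hρm : ∀ a, ρP a = m.appTop (ρX a)) (hρr : ∀ a, ρP a = (𝟙 P : P ⟶ P).appTop (ρP a))
  (hρsw : ∀ a, ρP a = sw.appTop (ρP a)) (hρi₁ : ∀ a, ρX a = i₁.appTop (ρP a))
  (hρi₂ : ∀ a, ρX a = i₂.appTop (ρP a))

/-! ## Slices after projections -/

/-- **`i₁^*(p₁^*(y)) = y`** (`i₁ ≫ p₁ = 𝟙`; the composite index map `i ↦ (i, j₀) ↦ i` is the identity).
[cite: StacksProject, Tag 01FP] [cite: MumfordAV1970, §13] -/
theorem prodCover_slice₁_proj₁_apply (i₁_p₁ : i₁ ≫ p₁ = 𝟙 X) (n : ℤ)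
    (y : (cechComplex U (unitModule X) ρX).homology n) :
    (HomologicalComplex.homologyMap (refineComplexMap (fun i : ι => toLex (i, j₀))
        (pullbackSystemHom i₁ W₀ U (fun i : ι => toLex (i, j₀)) hi₁ ρP ρX hρi₁)) n).hom
      ((HomologicalComplex.homologyMap (refineComplexMap (fun c : ι ×ₗ ι => (ofLex c).1)
        (pullbackSystemHom p₁ U W₀ (fun c : ι ×ₗ ι => (ofLex c).1) hW₀p₁ ρX ρP hρp₁)) n).hom y) = y := by
  rw [homologyMap_pullbackSystemHom_comp_apply p₁ i₁ U W₀ U (fun c : ι ×ₗ ι => (ofLex c).1) hW₀p₁ (fun i : ι => toLex (i, j₀)) hi₁ ρX ρP ρX hρp₁ hρi₁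
    (𝟙 X) i₁_p₁ (fun i : ι => i) (fun _ => rfl) (fun c => (Scheme.Hom.id_preimage _).ge) (fun a => by simp) n y]
  exact homologyMap_pullbackSystemHom_id_apply U ρX (𝟙 X) rfl (fun i : ι => i) (fun _ => rfl) _ _ n y

/-- **`i₂^*(p₂^*(y)) = y`** (`i₂ ≫ p₂ = 𝟙`; composite index map `i ↦ (j₀, i) ↦ i`).
[cite: StacksProject, Tag 01FP] [cite: MumfordAV1970, §13] -/
theorem prodCover_slice₂_proj₂_apply (i₂_p₂ : i₂ ≫ p₂ = 𝟙 X) (n : ℤ)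
    (y : (cechComplex U (unitModule X) ρX).homology n) :
    (HomologicalComplex.homologyMap (refineComplexMap (fun i : ι => toLex (j₀, i))
        (pullbackSystemHom i₂ W₀ U (fun i : ι => toLex (j₀, i)) hi₂ ρP ρX hρi₂)) n).hom
      ((HomologicalComplex.homologyMap (refineComplexMap (fun c : ι ×ₗ ι => (ofLex c).2)
        (pullbackSystemHom p₂ U W₀ (fun c : ι ×ₗ ι => (ofLex c).2) hW₀p₂ ρX ρP hρp₂)) n).hom y) = y := by
  rw [homologyMap_pullbackSystemHom_comp_apply p₂ i₂ U W₀ U (fun c : ι ×ₗ ι => (ofLex c).2) hW₀p₂ (fun i : ι => toLex (j₀, i)) hi₂ ρX ρP ρX hρp₂ hρi₂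
    (𝟙 X) i₂_p₂ (fun i : ι => i) (fun _ => rfl) (fun c => (Scheme.Hom.id_preimage _).ge) (fun a => by simp) n y]
  exact homologyMap_pullbackSystemHom_id_apply U ρX (𝟙 X) rfl (fun i : ι => i) (fun _ => rfl) _ _ n y

/-- **`i₁^*(p₂^*(y)) = 0` in degree `n ≥ 1`** (the composite index map `i ↦ (i, j₀) ↦ j₀` is CONSTANT; no scheme
identity is used). [cite: StacksProject, Tag 01FG] [cite: MumfordAV1970, §13] -/
theorem prodCover_slice₁_proj₂_apply_eq_zero {n : ℤ} (hn : 1 ≤ n)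
    (y : (cechComplex U (unitModule X) ρX).homology n) :
    (HomologicalComplex.homologyMap (refineComplexMap (fun i : ι => toLex (i, j₀))
        (pullbackSystemHom i₁ W₀ U (fun i : ι => toLex (i, j₀)) hi₁ ρP ρX hρi₁)) n).hom
      ((HomologicalComplex.homologyMap (refineComplexMap (fun c : ι ×ₗ ι => (ofLex c).2)
        (pullbackSystemHom p₂ U W₀ (fun c : ι ×ₗ ι => (ofLex c).2) hW₀p₂ ρX ρP hρp₂)) n).hom y) = 0 := by
  have h1 : ∀ i : ι, U i ≤ (i₁ ≫ p₂) ⁻¹ᵁ U j₀ := fun i =>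
    (hi₁ i).trans (by rw [Scheme.Hom.comp_preimage]; exact Scheme.Hom.preimage_mono _ (hW₀p₂ _))
  have h2 : ∀ a, ρX a = (i₁ ≫ p₂).appTop (ρX a) := fun a => by
    rw [Scheme.Hom.comp_appTop, CommRingCat.comp_apply, ← hρp₂, ← hρi₁]
  rw [homologyMap_pullbackSystemHom_comp_apply p₂ i₁ U W₀ U (fun c : ι ×ₗ ι => (ofLex c).2) hW₀p₂ (fun i : ι => toLex (i, j₀)) hi₁ ρX ρP ρX hρp₂ hρi₁
    (i₁ ≫ p₂) rfl (fun _ : ι => j₀) (fun _ => rfl) h1 h2 n y]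
  exact homologyMap_pullbackSystemHom_apply_eq_zero_of_const (i₁ ≫ p₂) U U (fun _ : ι => j₀) h1 ρX ρX h2 j₀
    (fun _ => rfl) hn y

/-- **`i₂^*(p₁^*(y)) = 0` in degree `n ≥ 1`** (composite index map `i ↦ (j₀, i) ↦ j₀` constant).
[cite: StacksProject, Tag 01FG] [cite: MumfordAV1970, §13] -/
theorem prodCover_slice₂_proj₁_apply_eq_zero {n : ℤ} (hn : 1 ≤ n)
    (y : (cechComplex U (unitModule X) ρX).homology n) :
    (HomologicalComplex.homologyMap (refineComplexMap (fun i : ι => toLex (j₀, i))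
        (pullbackSystemHom i₂ W₀ U (fun i : ι => toLex (j₀, i)) hi₂ ρP ρX hρi₂)) n).hom
      ((HomologicalComplex.homologyMap (refineComplexMap (fun c : ι ×ₗ ι => (ofLex c).1)
        (pullbackSystemHom p₁ U W₀ (fun c : ι ×ₗ ι => (ofLex c).1) hW₀p₁ ρX ρP hρp₁)) n).hom y) = 0 := by
  have h1 : ∀ i : ι, U i ≤ (i₂ ≫ p₁) ⁻¹ᵁ U j₀ := fun i =>
    (hi₂ i).trans (by rw [Scheme.Hom.comp_preimage]; exact Scheme.Hom.preimage_mono _ (hW₀p₁ _))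
  have h2 : ∀ a, ρX a = (i₂ ≫ p₁).appTop (ρX a) := fun a => by
    rw [Scheme.Hom.comp_appTop, CommRingCat.comp_apply, ← hρp₁, ← hρi₂]
  rw [homologyMap_pullbackSystemHom_comp_apply p₁ i₂ U W₀ U (fun c : ι ×ₗ ι => (ofLex c).1) hW₀p₁ (fun i : ι => toLex (j₀, i)) hi₂ ρX ρP ρX hρp₁ hρi₂
    (i₂ ≫ p₁) rfl (fun _ : ι => j₀) (fun _ => rfl) h1 h2 n y]
  exact homologyMap_pullbackSystemHom_apply_eq_zero_of_const (i₂ ≫ p₁) U U (fun _ : ι => j₀) h1 ρX ρX h2 j₀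
    (fun _ => rfl) hn y

/-! ## Swap after projections -/

/-- **`sw^*(p₁^*(y)) = p₂^*(y)`** (`sw ≫ p₁ = p₂`; composite index map `(i, j) ↦ (j, i) ↦ j` is `snd`).
[cite: StacksProject, Tag 01FP] [cite: MumfordAV1970, §13] -/
theorem prodCover_swap_proj₁_apply (sw_p₁ : sw ≫ p₁ = p₂) (n : ℤ)
    (y : (cechComplex U (unitModule X) ρX).homology n) :
    (HomologicalComplex.homologyMap (refineComplexMap (fun c : ι ×ₗ ι => toLex ((ofLex c).2, (ofLex c).1))
        (pullbackSystemHom sw W₀ W₀ (fun c : ι ×ₗ ι => toLex ((ofLex c).2, (ofLex c).1)) hsw ρP ρP hρsw)) n).hom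
      ((HomologicalComplex.homologyMap (refineComplexMap (fun c : ι ×ₗ ι => (ofLex c).1)
        (pullbackSystemHom p₁ U W₀ (fun c : ι ×ₗ ι => (ofLex c).1) hW₀p₁ ρX ρP hρp₁)) n).hom y) =
      (HomologicalComplex.homologyMap (refineComplexMap (fun c : ι ×ₗ ι => (ofLex c).2)
        (pullbackSystemHom p₂ U W₀ (fun c : ι ×ₗ ι => (ofLex c).2) hW₀p₂ ρX ρP hρp₂)) n).hom y := by
  exact homologyMap_pullbackSystemHom_comp_apply p₁ sw U W₀ W₀ (fun c : ι ×ₗ ι => (ofLex c).1) hW₀p₁ (fun c : ι ×ₗ ι => toLex ((ofLex c).2, (ofLex c).1)) hsw ρX ρP ρP hρp₁ hρsw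
    p₂ sw_p₁ (fun c : ι ×ₗ ι => (ofLex c).2) (fun _ => rfl) hW₀p₂ hρp₂ n y

/-- **`sw^*(p₂^*(y)) = p₁^*(y)`** (`sw ≫ p₂ = p₁`; composite index map `fst`).
[cite: StacksProject, Tag 01FP] [cite: MumfordAV1970, §13] -/
theorem prodCover_swap_proj₂_apply (sw_p₂ : sw ≫ p₂ = p₁) (n : ℤ)
    (y : (cechComplex U (unitModule X) ρX).homology n) :
    (HomologicalComplex.homologyMap (refineComplexMap (fun c : ι ×ₗ ι => toLex ((ofLex c).2, (ofLex c).1))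
        (pullbackSystemHom sw W₀ W₀ (fun c : ι ×ₗ ι => toLex ((ofLex c).2, (ofLex c).1)) hsw ρP ρP hρsw)) n).hom
      ((HomologicalComplex.homologyMap (refineComplexMap (fun c : ι ×ₗ ι => (ofLex c).2)
        (pullbackSystemHom p₂ U W₀ (fun c : ι ×ₗ ι => (ofLex c).2) hW₀p₂ ρX ρP hρp₂)) n).hom y) =
      (HomologicalComplex.homologyMap (refineComplexMap (fun c : ι ×ₗ ι => (ofLex c).1)
        (pullbackSystemHom p₁ U W₀ (fun c : ι ×ₗ ι => (ofLex c).1) hW₀p₁ ρX ρP hρp₁)) n).hom y := by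
  exact homologyMap_pullbackSystemHom_comp_apply p₂ sw U W₀ W₀ (fun c : ι ×ₗ ι => (ofLex c).2) hW₀p₂ (fun c : ι ×ₗ ι => toLex ((ofLex c).2, (ofLex c).1)) hsw ρX ρP ρP hρp₂ hρsw
    p₁ sw_p₂ (fun c : ι ×ₗ ι => (ofLex c).1) (fun _ => rfl) hW₀p₁ hρp₁ n y

/-! ## Slices and swap after the group law `m^* = (r^*)⁻¹ ∘ m_W^*` -/

include hW hi₁ in
omit [LinearOrder ι] in
/-- The slice `i₁` is admissible for the TRIPLE cover with the index map `i ↦ ((i, j₀), i)` when `i₁ ≫ m = 𝟙`.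
[cite: StacksProject, Tag 01FG] -/
theorem prodCover_slice₁_le_preimage_triple (i₁_m : i₁ ≫ m = 𝟙 X) (i : ι) :
    U i ≤ i₁ ⁻¹ᵁ W (toLex (toLex (i, j₀), i)) := by
  rw [hW, Scheme.Hom.preimage_inf, ← Scheme.Hom.comp_preimage, i₁_m, Scheme.Hom.id_preimage]
  exact le_inf (hi₁ i) le_rfl

include hW hi₂ in
omit [LinearOrder ι] in
/-- The slice `i₂` is admissible for the TRIPLE cover with the index map `i ↦ ((j₀, i), i)` when `i₂ ≫ m = 𝟙`.
[cite: StacksProject, Tag 01FG] -/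
theorem prodCover_slice₂_le_preimage_triple (i₂_m : i₂ ≫ m = 𝟙 X) (i : ι) :
    U i ≤ i₂ ⁻¹ᵁ W (toLex (toLex (j₀, i), i)) := by
  rw [hW, Scheme.Hom.preimage_inf, ← Scheme.Hom.comp_preimage, i₂_m, Scheme.Hom.id_preimage]
  exact le_inf (hi₂ i) le_rfl

include hW hsw in
omit [LinearOrder ι] in
/-- The swap is admissible for the TRIPLE cover with the index map `((i, j), l) ↦ ((j, i), l)` when `sw ≫ m = m`.
[cite: StacksProject, Tag 01FG] -/
theorem prodCover_swap_le_preimage_triple (sw_m : sw ≫ m = m) (c : (ι ×ₗ ι) ×ₗ ι) :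
    W c ≤ sw ⁻¹ᵁ W (toLex (toLex ((ofLex (ofLex c).1).2, (ofLex (ofLex c).1).1), (ofLex c).2)) := by
  rw [hW, hW, Scheme.Hom.preimage_inf, ← Scheme.Hom.comp_preimage, sw_m]
  exact inf_le_inf (hsw _) le_rfl

include hW in
/-- **`i₁^*(m^*(y)) = y`** where `m^* := (r^*)⁻¹ ∘ m_W^*` (`i₁ ≫ m = 𝟙`): `i₁^* = i₁_W^* ∘ r^*` for the lift
`i₁_W : i ↦ ((i, j₀), i)`, and `i₁_W^* ∘ m_W^* = (i₁ ≫ m)^* = 𝟙` (composite index map the identity).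
[cite: StacksProject, Tag 01FP] [cite: MumfordAV1970, §13] -/
theorem prodCover_slice₁_mul_apply (i₁_m : i₁ ≫ m = 𝟙 X) (n : ℤ)
    (hr : Function.Bijective
      (HomologicalComplex.homologyMap (refineComplexMap (fun c : (ι ×ₗ ι) ×ₗ ι => (ofLex c).1)
        (pullbackSystemHom (𝟙 P) W₀ W (fun c : (ι ×ₗ ι) ×ₗ ι => (ofLex c).1) hWr ρP ρP hρr)) n).hom)
    (y : (cechComplex U (unitModule X) ρX).homology n) :
    (HomologicalComplex.homologyMap (refineComplexMap (fun i : ι => toLex (i, j₀))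
        (pullbackSystemHom i₁ W₀ U (fun i : ι => toLex (i, j₀)) hi₁ ρP ρX hρi₁)) n).hom
      ((LinearEquiv.ofBijective
        (HomologicalComplex.homologyMap (refineComplexMap (fun c : (ι ×ₗ ι) ×ₗ ι => (ofLex c).1)
        (pullbackSystemHom (𝟙 P) W₀ W (fun c : (ι ×ₗ ι) ×ₗ ι => (ofLex c).1) hWr ρP ρP hρr)) n).hom hr).symm
        ((HomologicalComplex.homologyMap (refineComplexMap (fun c : (ι ×ₗ ι) ×ₗ ι => (ofLex c).2)
        (pullbackSystemHom m U W (fun c : (ι ×ₗ ι) ×ₗ ι => (ofLex c).2) hWm ρX ρP hρm)) n).hom y)) = y := by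
  have hw := (LinearEquiv.ofBijective
    (HomologicalComplex.homologyMap (refineComplexMap (fun c : (ι ×ₗ ι) ×ₗ ι => (ofLex c).1)
        (pullbackSystemHom (𝟙 P) W₀ W (fun c : (ι ×ₗ ι) ×ₗ ι => (ofLex c).1) hWr ρP ρP hρr)) n).hom hr).apply_symm_apply
    ((HomologicalComplex.homologyMap (refineComplexMap (fun c : (ι ×ₗ ι) ×ₗ ι => (ofLex c).2)
        (pullbackSystemHom m U W (fun c : (ι ×ₗ ι) ×ₗ ι => (ofLex c).2) hWm ρX ρP hρm)) n).hom y)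
  rw [LinearEquiv.ofBijective_apply] at hw
  have hi₁W := prodCover_slice₁_le_preimage_triple m i₁ U W₀ W hW j₀ hi₁ i₁_m
  rw [← homologyMap_pullbackSystemHom_comp_apply (𝟙 P) i₁ W₀ W U (fun c : (ι ×ₗ ι) ×ₗ ι => (ofLex c).1) hWr (fun i : ι => toLex (toLex (i, j₀), i)) hi₁W ρP ρP ρX hρr hρi₁
    i₁ (Category.comp_id _) (fun i : ι => toLex (i, j₀)) (fun _ => rfl) hi₁ hρi₁ n, hw,
    homologyMap_pullbackSystemHom_comp_apply m i₁ U W U (fun c : (ι ×ₗ ι) ×ₗ ι => (ofLex c).2) hWm (fun i : ι => toLex (toLex (i, j₀), i)) hi₁W ρX ρP ρX hρm hρi₁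
    (𝟙 X) i₁_m (fun i : ι => i) (fun _ => rfl) (fun c => (Scheme.Hom.id_preimage _).ge) (fun a => by simp) n y]
  exact homologyMap_pullbackSystemHom_id_apply U ρX (𝟙 X) rfl (fun i : ι => i) (fun _ => rfl) _ _ n y

include hW in
/-- **`i₂^*(m^*(y)) = y`** where `m^* := (r^*)⁻¹ ∘ m_W^*` (`i₂ ≫ m = 𝟙`; lift `i₂_W : i ↦ ((j₀, i), i)`).
[cite: StacksProject, Tag 01FP] [cite: MumfordAV1970, §13] -/
theorem prodCover_slice₂_mul_apply (i₂_m : i₂ ≫ m = 𝟙 X) (n : ℤ)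
    (hr : Function.Bijective
      (HomologicalComplex.homologyMap (refineComplexMap (fun c : (ι ×ₗ ι) ×ₗ ι => (ofLex c).1)
        (pullbackSystemHom (𝟙 P) W₀ W (fun c : (ι ×ₗ ι) ×ₗ ι => (ofLex c).1) hWr ρP ρP hρr)) n).hom)
    (y : (cechComplex U (unitModule X) ρX).homology n) :
    (HomologicalComplex.homologyMap (refineComplexMap (fun i : ι => toLex (j₀, i))
        (pullbackSystemHom i₂ W₀ U (fun i : ι => toLex (j₀, i)) hi₂ ρP ρX hρi₂)) n).hom
      ((LinearEquiv.ofBijective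
        (HomologicalComplex.homologyMap (refineComplexMap (fun c : (ι ×ₗ ι) ×ₗ ι => (ofLex c).1)
        (pullbackSystemHom (𝟙 P) W₀ W (fun c : (ι ×ₗ ι) ×ₗ ι => (ofLex c).1) hWr ρP ρP hρr)) n).hom hr).symm
        ((HomologicalComplex.homologyMap (refineComplexMap (fun c : (ι ×ₗ ι) ×ₗ ι => (ofLex c).2)
        (pullbackSystemHom m U W (fun c : (ι ×ₗ ι) ×ₗ ι => (ofLex c).2) hWm ρX ρP hρm)) n).hom y)) = y := by
  have hw := (LinearEquiv.ofBijective
    (HomologicalComplex.homologyMap (refineComplexMap (fun c : (ι ×ₗ ι) ×ₗ ι => (ofLex c).1)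
        (pullbackSystemHom (𝟙 P) W₀ W (fun c : (ι ×ₗ ι) ×ₗ ι => (ofLex c).1) hWr ρP ρP hρr)) n).hom hr).apply_symm_apply
    ((HomologicalComplex.homologyMap (refineComplexMap (fun c : (ι ×ₗ ι) ×ₗ ι => (ofLex c).2)
        (pullbackSystemHom m U W (fun c : (ι ×ₗ ι) ×ₗ ι => (ofLex c).2) hWm ρX ρP hρm)) n).hom y)
  rw [LinearEquiv.ofBijective_apply] at hw
  have hi₂W := prodCover_slice₂_le_preimage_triple m i₂ U W₀ W hW j₀ hi₂ i₂_m
  rw [← homologyMap_pullbackSystemHom_comp_apply (𝟙 P) i₂ W₀ W U (fun c : (ι ×ₗ ι) ×ₗ ι => (ofLex c).1) hWr (fun i : ι => toLex (toLex (j₀, i), i)) hi₂W ρP ρP ρX hρr hρi₂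
    i₂ (Category.comp_id _) (fun i : ι => toLex (j₀, i)) (fun _ => rfl) hi₂ hρi₂ n, hw,
    homologyMap_pullbackSystemHom_comp_apply m i₂ U W U (fun c : (ι ×ₗ ι) ×ₗ ι => (ofLex c).2) hWm (fun i : ι => toLex (toLex (j₀, i), i)) hi₂W ρX ρP ρX hρm hρi₂
    (𝟙 X) i₂_m (fun i : ι => i) (fun _ => rfl) (fun c => (Scheme.Hom.id_preimage _).ge) (fun a => by simp) n y]
  exact homologyMap_pullbackSystemHom_id_apply U ρX (𝟙 X) rfl (fun i : ι => i) (fun _ => rfl) _ _ n y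

include hW in
/-- **`sw^*(m^*(y)) = m^*(y)`** where `m^* := (r^*)⁻¹ ∘ m_W^*` (`sw ≫ m = m`: commutativity of the group law):
`r^* ∘ sw^* = sw_W^* ∘ r^*` for the lift `sw_W : ((i,j),l) ↦ ((j,i),l)` (both are `sw^*` with the index map
`((i,j),l) ↦ (j,i)`), `sw_W^* ∘ m_W^* = (sw ≫ m)^* = m_W^*`, and `r^*` is injective.
[cite: StacksProject, Tag 01FP] [cite: MumfordAV1970, §13] -/
theorem prodCover_swap_mul_apply (sw_m : sw ≫ m = m) (n : ℤ)
    (hr : Function.Bijective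
      (HomologicalComplex.homologyMap (refineComplexMap (fun c : (ι ×ₗ ι) ×ₗ ι => (ofLex c).1)
        (pullbackSystemHom (𝟙 P) W₀ W (fun c : (ι ×ₗ ι) ×ₗ ι => (ofLex c).1) hWr ρP ρP hρr)) n).hom)
    (y : (cechComplex U (unitModule X) ρX).homology n) :
    (HomologicalComplex.homologyMap (refineComplexMap (fun c : ι ×ₗ ι => toLex ((ofLex c).2, (ofLex c).1))
        (pullbackSystemHom sw W₀ W₀ (fun c : ι ×ₗ ι => toLex ((ofLex c).2, (ofLex c).1)) hsw ρP ρP hρsw)) n).hom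
      ((LinearEquiv.ofBijective
        (HomologicalComplex.homologyMap (refineComplexMap (fun c : (ι ×ₗ ι) ×ₗ ι => (ofLex c).1)
        (pullbackSystemHom (𝟙 P) W₀ W (fun c : (ι ×ₗ ι) ×ₗ ι => (ofLex c).1) hWr ρP ρP hρr)) n).hom hr).symm
        ((HomologicalComplex.homologyMap (refineComplexMap (fun c : (ι ×ₗ ι) ×ₗ ι => (ofLex c).2)
        (pullbackSystemHom m U W (fun c : (ι ×ₗ ι) ×ₗ ι => (ofLex c).2) hWm ρX ρP hρm)) n).hom y)) =
      (LinearEquiv.ofBijective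
        (HomologicalComplex.homologyMap (refineComplexMap (fun c : (ι ×ₗ ι) ×ₗ ι => (ofLex c).1)
        (pullbackSystemHom (𝟙 P) W₀ W (fun c : (ι ×ₗ ι) ×ₗ ι => (ofLex c).1) hWr ρP ρP hρr)) n).hom hr).symm
        ((HomologicalComplex.homologyMap (refineComplexMap (fun c : (ι ×ₗ ι) ×ₗ ι => (ofLex c).2)
        (pullbackSystemHom m U W (fun c : (ι ×ₗ ι) ×ₗ ι => (ofLex c).2) hWm ρX ρP hρm)) n).hom y) := by
  have hw := (LinearEquiv.ofBijective
    (HomologicalComplex.homologyMap (refineComplexMap (fun c : (ι ×ₗ ι) ×ₗ ι => (ofLex c).1)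
        (pullbackSystemHom (𝟙 P) W₀ W (fun c : (ι ×ₗ ι) ×ₗ ι => (ofLex c).1) hWr ρP ρP hρr)) n).hom hr).apply_symm_apply
    ((HomologicalComplex.homologyMap (refineComplexMap (fun c : (ι ×ₗ ι) ×ₗ ι => (ofLex c).2)
        (pullbackSystemHom m U W (fun c : (ι ×ₗ ι) ×ₗ ι => (ofLex c).2) hWm ρX ρP hρm)) n).hom y)
  rw [LinearEquiv.ofBijective_apply] at hw
  have hswW := prodCover_swap_le_preimage_triple m sw U W₀ W hW hsw sw_m
  -- the common composite `sw^*` from `W₀` to the triple cover, index map `((i,j),l) ↦ (j,i)`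
  have hθc' : ∀ c : (ι ×ₗ ι) ×ₗ ι, W c ≤ sw ⁻¹ᵁ W₀ (toLex ((ofLex (ofLex c).1).2, (ofLex (ofLex c).1).1)) :=
    fun c => (hWr c).trans (by rw [Scheme.Hom.id_preimage]; exact hsw _)
  apply hr.1
  rw [hw, homologyMap_pullbackSystemHom_comp_apply sw (𝟙 P) W₀ W₀ W (fun c : ι ×ₗ ι => toLex ((ofLex c).2, (ofLex c).1)) hsw (fun c : (ι ×ₗ ι) ×ₗ ι => (ofLex c).1) hWr ρP ρP ρP hρsw hρr
    sw (Category.id_comp _) (fun c : (ι ×ₗ ι) ×ₗ ι => toLex ((ofLex (ofLex c).1).2, (ofLex (ofLex c).1).1)) (fun _ => rfl) hθc' hρsw n,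
    ← homologyMap_pullbackSystemHom_comp_apply (𝟙 P) sw W₀ W W (fun c : (ι ×ₗ ι) ×ₗ ι => (ofLex c).1) hWr (fun c : (ι ×ₗ ι) ×ₗ ι => toLex (toLex ((ofLex (ofLex c).1).2, (ofLex (ofLex c).1).1), (ofLex c).2)) hswW ρP ρP ρP hρr hρsw
    sw (Category.comp_id _) (fun c : (ι ×ₗ ι) ×ₗ ι => toLex ((ofLex (ofLex c).1).2, (ofLex (ofLex c).1).1)) (fun _ => rfl) hθc' hρsw n,
    hw, homologyMap_pullbackSystemHom_comp_apply m sw U W W (fun c : (ι ×ₗ ι) ×ₗ ι => (ofLex c).2) hWm (fun c : (ι ×ₗ ι) ×ₗ ι => toLex (toLex ((ofLex (ofLex c).1).2, (ofLex (ofLex c).1).1), (ofLex c).2)) hswW ρX ρP ρP hρm hρsw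
    m sw_m (fun c : (ι ×ₗ ι) ×ₗ ι => (ofLex c).2) (fun _ => rfl) hWm hρm n y]

end Literature.AlgebraicGeometry.Modules

end
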